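import Literature.Barriers.AtomisticToContinuum.OneDimensionalHardCoreRodsLenard
import Literature.Barriers.AtomisticToContinuum.OneDimensionalHardCoreRodsBessel
import HarnessLib

/-!
# Hard rods, Part G′: the Hilbert–Schmidt deficiency of Lenard's rod matrix

`Literature/Barriers/AtomisticToContinuum/` (D-0021 barrier catalogue), sub-problem
`BoseEinsteinCondensation`; part of the typed proof of the rod barrier `OneDimensionalHardRods`
(`OneDimensionalHardCoreRods.lean`, eighth audit of `OneDimensionalHardCore`, 2026-08-16).

Step (5) of the paper proof. For Lenard's rod matrix `A = rodMatrix n L' a t`,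
`A_{kl} = δ_{kl} − q_{(0,t)}(k−l) − c_l q_{(0,t−a)}(k−l)`, `c_l = rodPhase n L' a l`
(`OneDimensionalHardCoreRodsLenard.lean`), and `0 ≤ a ≤ t ≤ L'`, the Hilbert–Schmidt deficiency
is bounded below column by column:

`(n + 1) − ∑_{k,l} |A_{kl}|² ≥ ∑_{l ≤ n} |1 + c_l|² sin²(π(t−a)/L') / (36π²(l+1))`

(`deficiency_lower_bound`), with `|1 + c_l|² = 2 + 2 Re c_l = 4cos²(π(n−2l)a/(2L'))`
(`norm_sq_one_add_rodPhase`). Ingredients, all elementary and Bessel-only as in Part G of the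
Proofs file: splitting `q_{(0,t)} = q_{(0,t−a)} + q_{(t−a,t)}` (`qCoeff_split`), the column
identity `1 − ∑_k|A_{kl}|² = 2Re z_{ll} − ∑_k|z_{kl}|²` for `A = 1 − z` (`one_sub_sum_norm_sq_col`),
Bessel (`bessel_ez`) for the two-step function `1_{(t−a,t)} + (1+c_l)1_{(0,t−a)}` whose plane-wave
coefficients are the `z_{kl}` (`ezCoeff_rodStep`), Bessel for the window indicator
(`sum_norm_sq_qCoeff_le`), `|u+v|² ≥ |v|²/2 − |u|²`, and the Proofs file's
`tail_block_lower_bound` on the frequency block `{l+1,…,3l+2}`. At `a = 0` (`c_l = 1`) this is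
`4 V_N ≥ sin² H_N · 2/(9π²)` up to the factor lost in `|u+v|² ≥ |v|²/2 − |u|²`.

## References

* [ForresterEtAl2003] P. J. Forrester et al., Phys. Rev. A 67 (2003) 043607: §2.1.2.
* [MazzantiEtAl2008] F. Mazzanti et al., Phys. Rev. Lett. 100 (2008) 020401: Eqs. (2)–(3), (5).
-/

noncomputable section

open MeasureTheory Finset Complex Matrix
open scoped BigOperators Real ComplexConjugate

namespace Literature.Barriers.AtomisticToContinuum.BoseGas

section Deficiency

variable {n : ℕ} {Lp a t : ℝ}

/-! #### Elementary facts on the rod phases and the arc coefficients -/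

/-- The rod phases are unimodular. [folklore] -/
theorem norm_rodPhase (n : ℕ) (Lp a : ℝ) (l : ℕ) : ‖rodPhase n Lp a l‖ = 1 := by
  unfold rodPhase
  rw [norm_mul, norm_exp_ofReal_mul_I, norm_pow, Complex.norm_conj, norm_eL, one_pow, mul_one]

/-- For a unimodular `c`, `2 Re(1 + c) = |1 + c|²`. [folklore] -/
theorem two_mul_re_one_add {c : ℂ} (hc : ‖c‖ = 1) : 2 * (1 + c).re = ‖1 + c‖ ^ 2 := by
  have h : ‖1 + c‖ ^ 2 = ‖(1 : ℂ)‖ ^ 2 + ‖c‖ ^ 2 + 2 * ((1 : ℂ) * conj c).re := by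
    rw [← Complex.normSq_eq_norm_sq, ← Complex.normSq_eq_norm_sq, ← Complex.normSq_eq_norm_sq,
      Complex.normSq_add]
  rw [h, hc, norm_one, one_mul, Complex.conj_re, Complex.add_re, Complex.one_re]
  ring

/-- `|1 + c_l|² = 4cos²(π(n − 2l)a/(2L'))` — the phase weights of the deficiency bound
(`c_l = e^{iθ}`, `θ = π(n−2l)a/L'`, `|1 + e^{iθ}|² = 2 + 2cos θ`). [folklore] -/
theorem norm_sq_one_add_rodPhase (n : ℕ) (Lp a : ℝ) (l : ℕ) :
    ‖1 + rodPhase n Lp a l‖ ^ 2 = 4 * Real.cos (π * ((n : ℝ) - 2 * l) * a / (2 * Lp)) ^ 2 := by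
  set θ : ℝ := π * ((n : ℝ) - 2 * l) * a / Lp with hθ
  have hc : rodPhase n Lp a l = cexp (θ * I) := by
    unfold rodPhase eL
    rw [← Complex.exp_conj, ← Complex.exp_nat_mul, ← Complex.exp_add]
    congr 1
    simp only [map_mul, Complex.conj_ofReal, Complex.conj_I, hθ]
    push_cast
    field_simp
    ring
  rw [← two_mul_re_one_add (norm_rodPhase n Lp a l), hc, Complex.add_re, Complex.one_re,
    Complex.exp_ofReal_mul_I_re, show θ = 2 * (π * ((n : ℝ) - 2 * l) * a / (2 * Lp)) by
      rw [hθ]; ring, Real.cos_two_mul]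
  ring

/-- `‖q(−m)‖ = ‖q(m)‖` (the arc indicator is real). [folklore] -/
theorem norm_qCoeff_neg (L α β : ℝ) (m : ℤ) : ‖qCoeff L α β (-m)‖ = ‖qCoeff L α β m‖ := by
  rw [← qCoeff_conj, Complex.norm_conj]

/-- Additivity of the arc coefficients: `q_{(0,t)} = q_{(0,t−a)} + q_{(t−a,t)}` for
`0 ≤ a ≤ t`. [folklore] -/
theorem qCoeff_split (hLp : 0 < Lp) (ha : 0 ≤ a) (hat : a ≤ t) (m : ℤ) :
    qCoeff Lp 0 t m = qCoeff Lp 0 (t - a) m + qCoeff Lp (t - a) t m := by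
  have ht0 : 0 ≤ t := ha.trans hat
  have hτ : 0 ≤ t - a := sub_nonneg.mpr hat
  have hii : ∀ u w : ℝ, IntervalIntegrable (ez Lp m) volume u w := fun u w =>
    (continuous_ez Lp m).intervalIntegrable u w
  have hL0 : (Lp : ℂ) ≠ 0 := by exact_mod_cast hLp.ne'
  have hw : qCoeff Lp (t - a) t m = (Lp : ℂ)⁻¹ * ∫ x in (t - a)..t, ez Lp m x := by
    unfold qCoeff
    rw [min_eq_left (by linarith), max_eq_right (by linarith),
      intervalIntegral.integral_of_le (by linarith), integral_Ioc_eq_integral_Ioo]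
  apply mul_left_cancel₀ hL0
  rw [mul_add, ← intervalIntegral_ez_eq_qCoeff hLp ht0, ← intervalIntegral_ez_eq_qCoeff hLp hτ, hw,
    ← mul_assoc, mul_inv_cancel₀ hL0, one_mul,
    intervalIntegral.integral_add_adjacent_intervals (hii 0 (t - a)) (hii (t - a) t)]

/-! #### The column algebra `1 − ∑_k |δ_{kl} − z_{kl}|² = 2 Re z_{ll} − ∑_k |z_{kl}|²` -/

/-- The off-identity part of the rod matrix:
`z_{kl} = q_{(t−a,t)}(k−l) + (1 + c_l) q_{(0,t−a)}(k−l)`. [folklore] -/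
def rodZ (n : ℕ) (Lp a t : ℝ) (k l : Fin (n + 1)) : ℂ :=
  qCoeff Lp (t - a) t ((k : ℤ) - (l : ℤ)) +
    (1 + rodPhase n Lp a l) * qCoeff Lp 0 (t - a) ((k : ℤ) - (l : ℤ))

/-- `A = 1 − z`. [folklore] -/
theorem rodMatrix_eq_one_sub_rodZ (hLp : 0 < Lp) (ha : 0 ≤ a) (hat : a ≤ t) (k l : Fin (n + 1)) :
    rodMatrix n Lp a t k l = (if k = l then (1 : ℂ) else 0) - rodZ n Lp a t k l := by
  simp only [rodMatrix, of_apply, rodZ, qCoeff_split hLp ha hat]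
  ring

/-- Column identity: `∑_k |δ_{kl} − z_{kl}|² = 1 − 2 Re z_{ll} + ∑_k |z_{kl}|²`. [folklore] -/
theorem sum_norm_sq_ite_sub (z : Fin (n + 1) → ℂ) (l : Fin (n + 1)) :
    ∑ k, ‖(if k = l then (1 : ℂ) else 0) - z k‖ ^ 2 = 1 - 2 * (z l).re + ∑ k, ‖z k‖ ^ 2 := by
  have hpt : ∀ k, ‖(if k = l then (1 : ℂ) else 0) - z k‖ ^ 2 =
      ‖z k‖ ^ 2 + if k = l then 1 - 2 * (z k).re else 0 := by
    intro k
    split_ifs with h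
    · rw [← Complex.normSq_eq_norm_sq, ← Complex.normSq_eq_norm_sq, Complex.normSq_sub,
        Complex.normSq_one, one_mul, Complex.conj_re]
      ring
    · rw [zero_sub, norm_neg, add_zero]
  simp_rw [hpt]
  rw [Finset.sum_add_distrib, Finset.sum_ite_eq' Finset.univ l, if_pos (Finset.mem_univ l)]
  ring

/-! #### The two-step function and its plane-wave coefficients -/

/-- The two-step function `h_l = 1_{(t−a,t)} + (1 + c_l) 1_{(0,t−a)}` whose plane-wave
coefficients are the `z_{kl}`. [folklore] -/
def rodStep (n : ℕ) (Lp a t : ℝ) (l : Fin (n + 1)) (x : ℝ) : ℂ :=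
  (Set.Ioo (t - a) t).indicator (fun _ => (1 : ℂ)) x +
    (1 + rodPhase n Lp a l) * (Set.Ioo 0 (t - a)).indicator (fun _ => (1 : ℂ)) x

/-- `h_l` is measurable. [folklore] -/
theorem measurable_rodStep (n : ℕ) (Lp a t : ℝ) (l : Fin (n + 1)) :
    Measurable (rodStep n Lp a t l) := by
  unfold rodStep
  exact (measurable_const.indicator measurableSet_Ioo).add
    (measurable_const.mul (measurable_const.indicator measurableSet_Ioo))

/-- `|h_l| ≤ 3`. [folklore] -/
theorem norm_rodStep_le (n : ℕ) (Lp a t : ℝ) (l : Fin (n + 1)) (x : ℝ) :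
    ‖rodStep n Lp a t l x‖ ≤ 3 := by
  unfold rodStep
  have h1 : ‖(Set.Ioo (t - a) t).indicator (fun _ => (1 : ℂ)) x‖ ≤ 1 := by
    refine le_trans (norm_indicator_le_norm_self _ x) ?_; simp
  have h2 : ‖(Set.Ioo 0 (t - a)).indicator (fun _ => (1 : ℂ)) x‖ ≤ 1 := by
    refine le_trans (norm_indicator_le_norm_self _ x) ?_; simp
  have h3 : ‖1 + rodPhase n Lp a l‖ ≤ 2 := by
    refine (norm_add_le _ _).trans ?_
    rw [norm_one, norm_rodPhase]; norm_num
  calc ‖(Set.Ioo (t - a) t).indicator (fun _ => (1 : ℂ)) x +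
        (1 + rodPhase n Lp a l) * (Set.Ioo 0 (t - a)).indicator (fun _ => (1 : ℂ)) x‖
      ≤ ‖(Set.Ioo (t - a) t).indicator (fun _ => (1 : ℂ)) x‖ +
        ‖1 + rodPhase n Lp a l‖ * ‖(Set.Ioo 0 (t - a)).indicator (fun _ => (1 : ℂ)) x‖ := by
          rw [← norm_mul]; exact norm_add_le _ _
    _ ≤ 1 + 2 * 1 := by gcongr
    _ = 3 := by norm_num

/-- Plane-wave coefficients of an arc indicator: `L⁻¹∫₀ᴸ conj(e_m) 1_{(α,β)} = q_{(α,β)}(−m)` for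
`0 ≤ α ≤ β ≤ L`. [folklore] -/
theorem ezCoeff_indicator_Ioo {α β : ℝ} (h0 : 0 ≤ α) (hαβ : α ≤ β) (hβ : β ≤ Lp)
    (m : ℤ) :
    (Lp : ℂ)⁻¹ * ∫ x in Set.Icc 0 Lp, conj (ez Lp m x) * (Set.Ioo α β).indicator (fun _ => (1 : ℂ)) x =
      qCoeff Lp α β (-m) := by
  have hsub : Set.Ioo α β ⊆ Set.Icc 0 Lp := fun x hx => ⟨by linarith [hx.1], by linarith [hx.2]⟩
  have hpt : ∀ x, conj (ez Lp m x) * (Set.Ioo α β).indicator (fun _ => (1 : ℂ)) x =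
      (Set.Ioo α β).indicator (ez Lp (-m)) x := by
    intro x
    by_cases hx : x ∈ Set.Ioo α β
    · rw [Set.indicator_of_mem hx, Set.indicator_of_mem hx, mul_one, conj_ez]
    · rw [Set.indicator_of_notMem hx, Set.indicator_of_notMem hx, mul_zero]
  simp_rw [hpt]
  rw [setIntegral_indicator measurableSet_Ioo, Set.inter_eq_self_of_subset_right hsub]
  unfold qCoeff
  rw [min_eq_left hαβ, max_eq_right hαβ]

/-- **The `z_{kl}` are plane-wave coefficients of the two-step function**:
`ĥ_l(m) = q_{(t−a,t)}(−m) + (1 + c_l) q_{(0,t−a)}(−m)`. [folklore] -/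
theorem ezCoeff_rodStep (ha : 0 ≤ a) (hat : a ≤ t) (htL : t ≤ Lp)
    (l : Fin (n + 1)) (m : ℤ) :
    ezCoeff Lp (rodStep n Lp a t l) m =
      qCoeff Lp (t - a) t (-m) + (1 + rodPhase n Lp a l) * qCoeff Lp 0 (t - a) (-m) := by
  have hτ : 0 ≤ t - a := sub_nonneg.mpr hat
  have hint : ∀ α β : ℝ, IntegrableOn (fun x => conj (ez Lp m x) *
      (Set.Ioo α β).indicator (fun _ => (1 : ℂ)) x) (Set.Icc 0 Lp) := by
    intro α β
    refine Integrable.mono' (integrable_const (1 : ℝ)) ?_ (Filter.Eventually.of_forall fun x => ?_)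
    · exact ((Complex.continuous_conj.measurable.comp (continuous_ez Lp m).measurable).mul
        (measurable_const.indicator measurableSet_Ioo)).aestronglyMeasurable
    · rw [norm_mul, Complex.norm_conj, norm_ez, one_mul]
      refine le_trans (norm_indicator_le_norm_self _ x) ?_; simp
  unfold ezCoeff rodStep
  simp_rw [mul_add]
  rw [integral_add (hint _ _) ?_, mul_add, ezCoeff_indicator_Ioo hτ (by linarith) htL]
  · congr 1
    have hrew : (fun x => conj (ez Lp m x) * ((1 + rodPhase n Lp a l) *
        (Set.Ioo 0 (t - a)).indicator (fun _ => (1 : ℂ)) x)) = fun x => (1 + rodPhase n Lp a l) *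
        (conj (ez Lp m x) * (Set.Ioo 0 (t - a)).indicator (fun _ => (1 : ℂ)) x) := by
      funext x; ring
    rw [hrew, integral_const_mul, ← mul_assoc, mul_comm ((Lp : ℂ)⁻¹), mul_assoc,
      ezCoeff_indicator_Ioo le_rfl hτ (by linarith)]
  · have hrew : (fun x => conj (ez Lp m x) * ((1 + rodPhase n Lp a l) *
        (Set.Ioo 0 (t - a)).indicator (fun _ => (1 : ℂ)) x)) = fun x => (1 + rodPhase n Lp a l) *
        (conj (ez Lp m x) * (Set.Ioo 0 (t - a)).indicator (fun _ => (1 : ℂ)) x) := by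
      funext x; ring
    rw [hrew]
    exact (hint _ _).const_mul _

/-- `z_{kl} = ĥ_l(l − k)`. [folklore] -/
theorem rodZ_eq_ezCoeff (ha : 0 ≤ a) (hat : a ≤ t) (htL : t ≤ Lp)
    (k l : Fin (n + 1)) :
    rodZ n Lp a t k l = ezCoeff Lp (rodStep n Lp a t l) ((l : ℤ) - (k : ℤ)) := by
  rw [ezCoeff_rodStep ha hat htL, neg_sub]
  rfl

/-- `∫₀^{L'} |h_l|² = a + |1 + c_l|²(t − a)` (disjoint supports). [folklore] -/
theorem integral_norm_sq_rodStep (ha : 0 ≤ a) (hat : a ≤ t) (htL : t ≤ Lp)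
    (l : Fin (n + 1)) :
    ∫ x in Set.Icc 0 Lp, ‖rodStep n Lp a t l x‖ ^ 2 = a + ‖1 + rodPhase n Lp a l‖ ^ 2 * (t - a) := by
  have hτ : 0 ≤ t - a := sub_nonneg.mpr hat
  set C : ℝ := ‖1 + rodPhase n Lp a l‖ ^ 2 with hCdef
  have hpt : ∀ x, ‖rodStep n Lp a t l x‖ ^ 2 =
      (Set.Ioo (t - a) t).indicator (fun _ => (1 : ℝ)) x +
        C * (Set.Ioo 0 (t - a)).indicator (fun _ => (1 : ℝ)) x := by
    intro x
    unfold rodStep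
    by_cases h1 : x ∈ Set.Ioo (t - a) t
    · have h2 : x ∉ Set.Ioo 0 (t - a) := fun h => by linarith [h.2, h1.1]
      rw [Set.indicator_of_mem h1, Set.indicator_of_notMem h2, Set.indicator_of_mem h1,
        Set.indicator_of_notMem h2]
      simp
    · rw [Set.indicator_of_notMem h1, Set.indicator_of_notMem h1, zero_add, zero_add]
      by_cases h2 : x ∈ Set.Ioo 0 (t - a)
      · rw [Set.indicator_of_mem h2, Set.indicator_of_mem h2, mul_one, mul_one, hCdef]
      · rw [Set.indicator_of_notMem h2, Set.indicator_of_notMem h2, mul_zero, mul_zero, norm_zero]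
        ring
  simp_rw [hpt]
  have hI : ∀ α β : ℝ, IntegrableOn (fun x => (Set.Ioo α β).indicator (fun _ => (1 : ℝ)) x)
      (Set.Icc 0 Lp) := fun α β =>
    (integrable_const (1 : ℝ)).indicator measurableSet_Ioo
  have hval : ∀ α β : ℝ, 0 ≤ α → α ≤ β → β ≤ Lp →
      ∫ x in Set.Icc 0 Lp, (Set.Ioo α β).indicator (fun _ => (1 : ℝ)) x = β - α := by
    intro α β h0 hαβ hβ
    have hsub : Set.Ioo α β ⊆ Set.Icc 0 Lp := fun x hx => ⟨by linarith [hx.1], by linarith [hx.2]⟩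
    rw [setIntegral_indicator measurableSet_Ioo, Set.inter_eq_self_of_subset_right hsub,
      setIntegral_const, Real.volume_real_Ioo_of_le hαβ, smul_eq_mul, mul_one]
  rw [integral_add (hI _ _) ((hI _ _).const_mul C), integral_const_mul,
    hval _ _ hτ (by linarith) htL, hval _ _ le_rfl hτ (by linarith)]
  ring

/-! #### The frequency sets -/

/-- The frequencies `l − k`, `k ≤ n`, seen from column `l`. [folklore] -/
def colFreq (n : ℕ) (l : Fin (n + 1)) : Finset ℤ :=
  Finset.univ.image fun k : Fin (n + 1) => (l : ℤ) - (k : ℤ)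

/-- The tail block `{l+1, …, 3l+2}`. [folklore] -/
def tailFreq (l : ℕ) : Finset ℤ :=
  (Finset.range (2 * l + 2)).image fun i : ℕ => (l : ℤ) + 1 + i

/-- The column frequencies and the tail block are disjoint. [folklore] -/
theorem disjoint_colFreq_tailFreq (l : Fin (n + 1)) : Disjoint (colFreq n l) (tailFreq (l : ℕ)) := by
  rw [Finset.disjoint_left]
  intro m hm hm'
  simp only [colFreq, tailFreq, Finset.mem_image, Finset.mem_univ, true_and,
    Finset.mem_range] at hm hm'
  obtain ⟨k, rfl⟩ := hm
  obtain ⟨i, hi, h⟩ := hm'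
  have hk := k.is_le
  omega

/-- `∑_{m ∈ colFreq} |ĥ_l(m)|² = ∑_k |z_{kl}|²`. [folklore] -/
theorem sum_colFreq (ha : 0 ≤ a) (hat : a ≤ t) (htL : t ≤ Lp) (l : Fin (n + 1)) :
    ∑ m ∈ colFreq n l, ‖ezCoeff Lp (rodStep n Lp a t l) m‖ ^ 2 = ∑ k, ‖rodZ n Lp a t k l‖ ^ 2 := by
  unfold colFreq
  rw [Finset.sum_image]
  · refine Finset.sum_congr rfl fun k _ => ?_
    rw [rodZ_eq_ezCoeff ha hat htL]
  · intro k _ k' _ h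
    simp only at h
    exact Fin.ext (by omega)

/-- `∑_{m ∈ tailFreq} |q_{(t−a,t)}(−m)|² ≤ a/L'` (Bessel for the window indicator). [folklore] -/
theorem sum_tailFreq_window_le (hLp : 0 < Lp) (ha : 0 ≤ a) (hat : a ≤ t) (htL : t ≤ Lp) (l : ℕ) :
    ∑ m ∈ tailFreq l, ‖qCoeff Lp (t - a) t (-m)‖ ^ 2 ≤ a / Lp := by
  have hτ : t - a ∈ Set.Icc 0 Lp := ⟨sub_nonneg.mpr hat, by linarith⟩
  have ht : t ∈ Set.Icc 0 Lp := ⟨ha.trans hat, htL⟩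
  have h := sum_norm_sq_qCoeff_le hLp hτ ht ((tailFreq l).image fun m => -m)
  rw [Finset.sum_image (fun m _ m' _ h => neg_inj.mp h)] at h
  rwa [show |t - a - t| = a by rw [sub_sub_cancel_left, abs_neg, abs_of_nonneg ha]] at h

/-- `∑_{m ∈ tailFreq} |q_{(0,t−a)}(−m)|² ≥ sin²(π(t−a)/L')/(18π²(l+1))` (the Proofs file's
`tail_block_lower_bound`). [folklore] -/
theorem sum_tailFreq_main_ge (hLp : 0 < Lp) (l : ℕ) :
    Real.sin (π * (t - a) / Lp) ^ 2 / (18 * π ^ 2 * (l + 1)) ≤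
      ∑ m ∈ tailFreq l, ‖qCoeff Lp 0 (t - a) (-m)‖ ^ 2 := by
  have h := tail_block_lower_bound hLp 0 (t - a) l
  rw [show π * (0 - (t - a)) / Lp = -(π * (t - a) / Lp) by ring, Real.sin_neg, neg_sq] at h
  refine h.trans (le_of_eq ?_)
  unfold tailFreq
  rw [Finset.sum_image (fun i _ i' _ h => by exact_mod_cast (add_left_cancel h : (i : ℤ) = i'))]
  refine Finset.sum_congr rfl fun i _ => ?_
  rw [norm_qCoeff_neg]

/-! #### The column bound and the deficiency bound -/

/-- `|u + v|² ≥ |v|²/2 − |u|²`. [folklore] -/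
theorem norm_sq_add_ge (u v : ℂ) : ‖v‖ ^ 2 / 2 - ‖u‖ ^ 2 ≤ ‖u + v‖ ^ 2 := by
  have h : ‖v‖ ≤ ‖u + v‖ + ‖u‖ := by
    calc ‖v‖ = ‖(u + v) - u‖ := by rw [add_sub_cancel_left]
      _ ≤ ‖u + v‖ + ‖u‖ := norm_sub_le _ _
  nlinarith [norm_nonneg v, norm_nonneg u, norm_nonneg (u + v), sq_nonneg (‖u + v‖ - ‖u‖)]

/-- **Column bound.** For `0 ≤ a ≤ t ≤ L'` and every column `l`,
`1 − ∑_k |A_{kl}|² ≥ |1 + c_l|² sin²(π(t−a)/L') / (36π²(l+1))`. [folklore] -/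
theorem one_sub_sum_norm_sq_col_ge (hLp : 0 < Lp) (ha : 0 ≤ a) (hat : a ≤ t) (htL : t ≤ Lp)
    (l : Fin (n + 1)) :
    ‖1 + rodPhase n Lp a l‖ ^ 2 * Real.sin (π * (t - a) / Lp) ^ 2 / (36 * π ^ 2 * ((l : ℕ) + 1)) ≤
      1 - ∑ k, ‖rodMatrix n Lp a t k l‖ ^ 2 := by
  set c : ℂ := rodPhase n Lp a l with hc
  set C : ℝ := ‖1 + c‖ ^ 2 with hCdef
  set S := colFreq n l with hS
  set B := tailFreq (l : ℕ) with hB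
  have hτ : 0 ≤ t - a := sub_nonneg.mpr hat
  -- the column algebra
  have hcol : ∑ k, ‖rodMatrix n Lp a t k l‖ ^ 2 =
      1 - 2 * (rodZ n Lp a t l l).re + ∑ k, ‖rodZ n Lp a t k l‖ ^ 2 := by
    simp_rw [rodMatrix_eq_one_sub_rodZ hLp ha hat]
    exact sum_norm_sq_ite_sub (fun k => rodZ n Lp a t k l) l
  -- the diagonal entry
  have hdiag : 2 * (rodZ n Lp a t l l).re = 2 * (a / Lp) + C * ((t - a) / Lp) := by
    have hz : rodZ n Lp a t l l = ((a / Lp : ℝ) : ℂ) + (1 + c) * (((t - a) / Lp : ℝ) : ℂ) := by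
      simp only [rodZ, sub_self, qCoeff_zero, hc]
      rw [show |t - a - t| = a by rw [sub_sub_cancel_left, abs_neg, abs_of_nonneg ha],
        show |(0 : ℝ) - (t - a)| = t - a by rw [zero_sub, abs_neg, abs_of_nonneg hτ]]
    rw [hz, Complex.add_re, Complex.ofReal_re, Complex.re_mul_ofReal, mul_add, hCdef,
      ← two_mul_re_one_add (norm_rodPhase n Lp a l), ← hc]
    ring
  -- Bessel for the two-step function on `S ∪ B`
  have hBessel := bessel_ez hLp (measurable_rodStep n Lp a t l) (norm_rodStep_le n Lp a t l) (S ∪ B)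
  rw [Finset.sum_union (disjoint_colFreq_tailFreq l), sum_colFreq ha hat htL,
    integral_norm_sq_rodStep ha hat htL, ← hc, ← hCdef] at hBessel
  -- the tail block from below
  have htail : C / 2 * (Real.sin (π * (t - a) / Lp) ^ 2 / (18 * π ^ 2 * ((l : ℕ) + 1))) - a / Lp ≤
      ∑ m ∈ B, ‖ezCoeff Lp (rodStep n Lp a t l) m‖ ^ 2 := by
    have hpt : ∀ m ∈ B, C * ‖qCoeff Lp 0 (t - a) (-m)‖ ^ 2 / 2 - ‖qCoeff Lp (t - a) t (-m)‖ ^ 2 ≤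
        ‖ezCoeff Lp (rodStep n Lp a t l) m‖ ^ 2 := by
      intro m _
      rw [ezCoeff_rodStep ha hat htL, hCdef]
      have h := norm_sq_add_ge (qCoeff Lp (t - a) t (-m)) ((1 + c) * qCoeff Lp 0 (t - a) (-m))
      rw [norm_mul, mul_pow] at h
      linarith
    refine le_trans ?_ (Finset.sum_le_sum hpt)
    rw [Finset.sum_sub_distrib, ← Finset.sum_div, ← Finset.mul_sum]
    have h1 := sum_tailFreq_main_ge (t := t) (a := a) hLp (l : ℕ)
    have h2 := sum_tailFreq_window_le hLp ha hat htL (l : ℕ)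
    have hC0 : 0 ≤ C := sq_nonneg _
    rw [← hB] at h1 h2
    nlinarith
  -- assemble
  rw [hcol, hdiag]
  have hLp' : 0 < Lp := hLp
  have hkey : Lp * (∑ k, ‖rodZ n Lp a t k l‖ ^ 2 + ∑ m ∈ B, ‖ezCoeff Lp (rodStep n Lp a t l) m‖ ^ 2) ≤
      a + C * (t - a) := hBessel
  have hdiv : ∑ k, ‖rodZ n Lp a t k l‖ ^ 2 + ∑ m ∈ B, ‖ezCoeff Lp (rodStep n Lp a t l) m‖ ^ 2 ≤
      a / Lp + C * ((t - a) / Lp) := by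
    rw [div_eq_mul_inv, div_eq_mul_inv, ← mul_assoc, ← add_mul, ← div_eq_mul_inv,
      le_div_iff₀ hLp', mul_comm]
    exact hkey
  have hfinal : C / 2 * (Real.sin (π * (t - a) / Lp) ^ 2 / (18 * π ^ 2 * ((l : ℕ) + 1))) =
      C * Real.sin (π * (t - a) / Lp) ^ 2 / (36 * π ^ 2 * ((l : ℕ) + 1)) := by
    field_simp
    ring
  linarith

/-- **Deficiency bound for Lenard's rod matrix** (step (5) of the paper proof of
`OneDimensionalHardRods`): for `0 ≤ a ≤ t ≤ L'`,
`(n+1) − ∑_{k,l} |A_{kl}|² ≥ ∑_{l ≤ n} |1 + c_l|² sin²(π(t−a)/L') / (36π²(l+1))`,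
`|1 + c_l|² = 4cos²(π(n−2l)a/(2L'))`. [folklore] -/
theorem deficiency_lower_bound (hLp : 0 < Lp) (ha : 0 ≤ a) (hat : a ≤ t) (htL : t ≤ Lp) :
    ∑ l : Fin (n + 1), ‖1 + rodPhase n Lp a l‖ ^ 2 * Real.sin (π * (t - a) / Lp) ^ 2 /
        (36 * π ^ 2 * ((l : ℕ) + 1)) ≤
      ((n : ℝ) + 1) - ∑ k : Fin (n + 1), ∑ l : Fin (n + 1), ‖rodMatrix n Lp a t k l‖ ^ 2 := by
  rw [Finset.sum_comm]
  have hcard : ((n : ℝ) + 1) = ∑ _l : Fin (n + 1), (1 : ℝ) := by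
    rw [Finset.sum_const, Finset.card_univ, Fintype.card_fin, nsmul_eq_mul, mul_one]
    push_cast; ring
  rw [hcard, ← Finset.sum_sub_distrib]
  exact Finset.sum_le_sum fun l _ => one_sub_sum_norm_sq_col_ge hLp ha hat htL l

end Deficiency

end Literature.Barriers.AtomisticToContinuum.BoseGas

end
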